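import Mathlib
import HarnessLib
import Summits.ABC.ABC.Theses.GvfSupportTransfer

/-!
# Line `exceptional-curve` for crux `LinearLawTransfer` (stmt-ABC-11084) — registered skeleton

Strategist line (seat `planner-cstrat-stmt-ABC-11084-r1-0`, 2026-08-17): the EXCEPTIONAL-CURVE DECOMPOSITION of the crux
as a skeleton. Three registered stubs — the three split pieces, verbatim the children of `Cruxes/LinearLawTransfer/SPLIT.md`
(`children.json`) — and the kernel-checked composition `LinearLawTransfer_of`, whose proof is the assembly theorem
`Cruxes/LinearLawTransfer/StrategySplit.lean` (`linearLawTransfer_of_subs`, sorry-free). Sorries live ONLY in `stub_*`.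

* `stub_genericLawTransfer` (OPEN, the hard stub; ≥ abc modulo the other two): the law OFF a nonzero exceptional curve
  `G ∈ ℤ[X,Y]` — Vojta-shaped; its own birth skeleton (generic genus-negligible density + shadow bookkeeping) is
  `Cruxes/LinearLawTransfer/SplitGenericLawTransferBirth.lean`.
* `stub_lowGenusCurveLaw` (KNOWN on paper, size L): the law along rational points of a prime `P` with the genus-≤-1
  condition over `ℚ` — Weil height machine + Siegel's quasi-equivalence of heights on curves (Lang 1983 Ch. 4 Cor. 3.5);
  birth skeleton `Cruxes/LinearLawTransfer/SplitLowGenusCurveLawBirth.lean`.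
* `stub_planeMordell` (KNOWN, Faltings 1983 = Bombieri–Gubler Thm 11.1.1; size XL to formalise, may be vendored as a
  Literature fact): genus ≥ 2 ⇒ finitely many rational points; birth skeleton `Cruxes/LinearLawTransfer/SplitPlaneMordellBirth.lean`.

Composition: factor the exceptional `G` over `ℚ` into prime factors, a rational zero of `G` is a zero of a prime factor,
per-factor thresholds from stub 2 (genus ≤ 1) or vacuously above the finitely many points of stub 3 (genus ≥ 2),
`H₀ := max(H_G, Σ_P max(H_P,0))`.
-/

set_option linter.dupNamespace false

namespace Summit.ABC.ABC.Cruxes.LinearLawTransfer.ExceptionalCurve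

open Summit.ABC.ABC.Theses.GvfSupportTransfer
open scoped BigOperators

/-- **stub 1 (open, hardest) — GENERIC LAW TRANSFER**: linear law transfer off a nonzero exceptional curve `G = 0`. -/
theorem stub_genericLawTransfer :
    ∀ (m n : ℕ) (T : Fin m → Fin (n + 1) → MvPolynomial (Fin 2) ℤ) (c : Fin m → ℝ) (C : ℝ), (∀ (F : Type) [Field F] [Algebra ℂ F], Algebra.trdeg ℂ F = 1 → (⊤ : IntermediateField ℂ F).FG → ∀ g : ℕ, (∀ D : Literature.NumberTheory.DiophantineGeometry.AlgFunctionField.Divisor ℂ F, D.degree + 1 - (Literature.NumberTheory.DiophantineGeometry.AlgFunctionField.ell D : ℤ) ≤ g) → ∀ ξ η : F, (∀ j i, MvPolynomial.aeval ![ξ, η] (T j i) ≠ 0) → ∑ j, c j * ∑ᶠ v : Literature.NumberTheory.DiophantineGeometry.AlgFunctionField.PlaceOver ℂ F, ((v.degree : ℝ) * ⨆ i, (-(v.ord (MvPolynomial.aeval ![ξ, η] (T j i))) : ℝ)) ≤ C * max 0 (2 * (g : ℝ) - 2)) → ∀ δ : ℝ, 0 < δ → ∃ G : MvPolynomial (Fin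 2) ℤ, G ≠ 0 ∧ ∃ H₀ : ℝ, ∀ x y : ℚ, (∀ j i, MvPolynomial.aeval ![x, y] (T j i) ≠ 0) → MvPolynomial.aeval ![x, y] G ≠ 0 → H₀ ≤ Height.logHeight ![(1 : ℚ), x, y] → ∑ j, c j * Height.logHeight (fun i => MvPolynomial.aeval ![x, y] (T j i)) ≤ δ * Height.logHeight ![(1 : ℚ), x, y] := by
  sorry

/-- **stub 2 (known: Weil height machine + Siegel, Lang 1983 Ch.4 Cor.3.5) — LOW-GENUS CURVE LAW**: the law along the
rational points of a prime `P ∈ ℚ[X,Y]` whose function field satisfies `deg D + 1 − ℓ(D) ≤ 1` for all divisors over `ℚ`. -/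
theorem stub_lowGenusCurveLaw :
    ∀ (m n : ℕ) (T : Fin m → Fin (n + 1) → MvPolynomial (Fin 2) ℤ) (c : Fin m → ℝ) (C : ℝ), (∀ (F : Type) [Field F] [Algebra ℂ F], Algebra.trdeg ℂ F = 1 → (⊤ : IntermediateField ℂ F).FG → ∀ g : ℕ, (∀ D : Literature.NumberTheory.DiophantineGeometry.AlgFunctionField.Divisor ℂ F, D.degree + 1 - (Literature.NumberTheory.DiophantineGeometry.AlgFunctionField.ell D : ℤ) ≤ g) → ∀ ξ η : F, (∀ j i, MvPolynomial.aeval ![ξ, η] (T j i) ≠ 0) → ∑ j, c j * ∑ᶠ v : Literature.NumberTheory.DiophantineGeometry.AlgFunctionField.PlaceOver ℂ F, ((v.degree : ℝ) * ⨆ i, (-(v.ord (MvPolynomial.aeval ![ξ, η] (T j i))) : ℝ)) ≤ C * max 0 (2 * (g : ℝ) - 2)) → ∀ (P : MvPolynomial (Fin 2) ℚ) (hP : Prime P), (haveI : (Ideal.span {P}).IsPrime := (Ideal.span_singleton_prime hP.ne_zero).mpr hP; ∀ D : Literature.NumberTheory.DiophantineGeometry.AlgFunctionField.Divisor ℚ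 (FractionRing (MvPolynomial (Fin 2) ℚ ⧸ Ideal.span {P})), D.degree + 1 - (Literature.NumberTheory.DiophantineGeometry.AlgFunctionField.ell D : ℤ) ≤ 1) → ∀ δ : ℝ, 0 < δ → ∃ H₀ : ℝ, ∀ x y : ℚ, MvPolynomial.aeval ![x, y] P = 0 → (∀ j i, MvPolynomial.aeval ![x, y] (T j i) ≠ 0) → H₀ ≤ Height.logHeight ![(1 : ℚ), x, y] → ∑ j, c j * Height.logHeight (fun i => MvPolynomial.aeval ![x, y] (T j i)) ≤ δ * Height.logHeight ![(1 : ℚ), x, y] := by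
  sorry

/-- **stub 3 (known: Faltings 1983, B–G Thm 11.1.1) — PLANE MORDELL**: if the genus condition fails, `{P = 0}(ℚ)` is finite. -/
theorem stub_planeMordell :
    ∀ (P : MvPolynomial (Fin 2) ℚ) (hP : Prime P), (haveI : (Ideal.span {P}).IsPrime := (Ideal.span_singleton_prime hP.ne_zero).mpr hP; ¬ ∀ D : Literature.NumberTheory.DiophantineGeometry.AlgFunctionField.Divisor ℚ (FractionRing (MvPolynomial (Fin 2) ℚ ⧸ Ideal.span {P})), D.degree + 1 - (Literature.NumberTheory.DiophantineGeometry.AlgFunctionField.ell D : ℤ) ≤ 1) → Set.Finite {p : ℚ × ℚ | MvPolynomial.aeval ![p.1, p.2] P = 0} := by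
  sorry

/-- **Composition with the stub statements as hypotheses (sorry-free):**
`stub₁ → stub₂ → stub₃ → LinearLawTransfer` — the assembly of the exceptional-curve split (identical to
`Strategist.linearLawTransfer_of_subs` in `Cruxes/LinearLawTransfer/StrategySplit.lean`). [folklore] -/
theorem linearLawTransfer_of_stubs :
    (∀ (m n : ℕ) (T : Fin m → Fin (n + 1) → MvPolynomial (Fin 2) ℤ) (c : Fin m → ℝ) (C : ℝ), (∀ (F : Type) [Field F] [Algebra ℂ F], Algebra.trdeg ℂ F = 1 → (⊤ : IntermediateField ℂ F).FG → ∀ g : ℕ, (∀ D : Literature.NumberTheory.DiophantineGeometry.AlgFunctionField.Divisor ℂ F, D.degree + 1 - (Literature.NumberTheory.DiophantineGeometry.AlgFunctionField.ell D : ℤ) ≤ g) → ∀ ξ η : F, (∀ j i, MvPolynomial.aeval ![ξ, η] (T j i) ≠ 0) → ∑ j, c j * ∑ᶠ v : Literature.NumberTheory.DiophantineGeometry.AlgFunctionField.PlaceOver ℂ F, ((v.degree : ℝ) * ⨆ i, (-(v.ord (MvPolynomial.aeval ![ξ, η] (T j i))) : ℝ)) ≤ C * max 0 (2 * (g : ℝ)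 - 2)) → ∀ δ : ℝ, 0 < δ → ∃ G : MvPolynomial (Fin 2) ℤ, G ≠ 0 ∧ ∃ H₀ : ℝ, ∀ x y : ℚ, (∀ j i, MvPolynomial.aeval ![x, y] (T j i) ≠ 0) → MvPolynomial.aeval ![x, y] G ≠ 0 → H₀ ≤ Height.logHeight ![(1 : ℚ), x, y] → ∑ j, c j * Height.logHeight (fun i => MvPolynomial.aeval ![x, y] (T j i)) ≤ δ * Height.logHeight ![(1 : ℚ), x, y]) →
    (∀ (m n : ℕ) (T : Fin m → Fin (n + 1) → MvPolynomial (Fin 2) ℤ) (c : Fin m → ℝ) (C : ℝ), (∀ (F : Type) [Field F] [Algebra ℂ F], Algebra.trdeg ℂ F = 1 → (⊤ : IntermediateField ℂ F).FG → ∀ g : ℕ, (∀ D : Literature.NumberTheory.DiophantineGeometry.AlgFunctionField.Divisor ℂ F, D.degree + 1 - (Literature.NumberTheory.DiophantineGeometry.AlgFunctionField.ell D : ℤ) ≤ g) → ∀ ξ η : F, (∀ j i, MvPolynomial.aeval ![ξ, η] (T j i) ≠ 0) → ∑ j, c j * ∑ᶠ v : Literature.NumberTheory.DiophantineGeometry.AlgFunctionField.PlaceOver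 ℂ F, ((v.degree : ℝ) * ⨆ i, (-(v.ord (MvPolynomial.aeval ![ξ, η] (T j i))) : ℝ)) ≤ C * max 0 (2 * (g : ℝ) - 2)) → ∀ (P : MvPolynomial (Fin 2) ℚ) (hP : Prime P), (haveI : (Ideal.span {P}).IsPrime := (Ideal.span_singleton_prime hP.ne_zero).mpr hP; ∀ D : Literature.NumberTheory.DiophantineGeometry.AlgFunctionField.Divisor ℚ (FractionRing (MvPolynomial (Fin 2) ℚ ⧸ Ideal.span {P})), D.degree + 1 - (Literature.NumberTheory.DiophantineGeometry.AlgFunctionField.ell D : ℤ) ≤ 1) → ∀ δ : ℝ, 0 < δ → ∃ H₀ : ℝ, ∀ x y : ℚ, MvPolynomial.aeval ![x, y] P = 0 → (∀ j i, MvPolynomial.aeval ![x, y] (T j i) ≠ 0) → H₀ ≤ Height.logHeight ![(1 : ℚ), x, y] → ∑ j, c j * Height.logHeight (fun i => MvPolynomial.aeval ![x, y] (T j i)) ≤ δ * Height.logHeight ![(1 : ℚ), x, y]) →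
    (∀ (P : MvPolynomial (Fin 2) ℚ) (hP : Prime P), (haveI : (Ideal.span {P}).IsPrime := (Ideal.span_singleton_prime hP.ne_zero).mpr hP; ¬ ∀ D : Literature.NumberTheory.DiophantineGeometry.AlgFunctionField.Divisor ℚ (FractionRing (MvPolynomial (Fin 2) ℚ ⧸ Ideal.span {P})), D.degree + 1 - (Literature.NumberTheory.DiophantineGeometry.AlgFunctionField.ell D : ℤ) ≤ 1) → Set.Finite {p : ℚ × ℚ | MvPolynomial.aeval ![p.1, p.2] P = 0}) →
    Summit.ABC.ABC.Theses.GvfSupportTransfer.LinearLawTransfer := by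
  intro hA hB hM m n T c C hFF δ hδ
  classical
  obtain ⟨G, hG0, HA, hAH⟩ := hA m n T c C hFF δ hδ
  -- the exceptional polynomial over `ℚ`
  set G' : MvPolynomial (Fin 2) ℚ := MvPolynomial.map (Int.castRingHom ℚ) G with hG'def
  have hG'0 : G' ≠ 0 := by
    intro h
    apply hG0
    apply MvPolynomial.map_injective (Int.castRingHom ℚ) (Int.castRingHom ℚ).injective_int
    rw [map_zero]
    exact h
  have haevalG' : ∀ x y : ℚ, MvPolynomial.aeval ![x, y] G' = MvPolynomial.aeval ![x, y] G := by
    intro x y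
    rw [hG'def, show Int.castRingHom ℚ = algebraMap ℤ ℚ from rfl, MvPolynomial.aeval_map_algebraMap]
  -- prime factors of `G'`
  set S : Finset (MvPolynomial (Fin 2) ℚ) := (UniqueFactorizationMonoid.factors G').toFinset with hSdef
  have hSprime : ∀ P ∈ S, Prime P := fun P hP =>
    UniqueFactorizationMonoid.prime_of_factor P (Multiset.mem_toFinset.mp hP)
  have hroot : ∀ x y : ℚ, MvPolynomial.aeval ![x, y] G = 0 →
      ∃ P ∈ S, MvPolynomial.aeval ![x, y] P = 0 := by
    intro x y hxy
    rw [← haevalG'] at hxy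
    obtain ⟨u, hu⟩ := UniqueFactorizationMonoid.factors_prod hG'0
    have hu' : MvPolynomial.aeval ![x, y] (UniqueFactorizationMonoid.factors G').prod *
        MvPolynomial.aeval ![x, y] (↑u : MvPolynomial (Fin 2) ℚ) = 0 := by
      rw [← map_mul, hu, hxy]
    have hunit : MvPolynomial.aeval ![x, y] (↑u : MvPolynomial (Fin 2) ℚ) ≠ 0 :=
      (Units.map (MvPolynomial.aeval ![x, y] : MvPolynomial (Fin 2) ℚ →ₐ[ℚ] ℚ).toMonoidHom u).ne_zero
    have hprod : MvPolynomial.aeval ![x, y] (UniqueFactorizationMonoid.factors G').prod = 0 :=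
      (mul_eq_zero.mp hu').resolve_right hunit
    rw [map_multiset_prod, Multiset.prod_eq_zero_iff, Multiset.mem_map] at hprod
    obtain ⟨P, hP, hP0⟩ := hprod
    exact ⟨P, Multiset.mem_toFinset.mpr hP, hP0⟩
  -- per-factor threshold
  have key : ∀ P : MvPolynomial (Fin 2) ℚ, Prime P → ∃ H : ℝ, ∀ x y : ℚ,
      MvPolynomial.aeval ![x, y] P = 0 → (∀ j i, MvPolynomial.aeval ![x, y] (T j i) ≠ 0) →
      H ≤ Height.logHeight ![(1 : ℚ), x, y] →
      ∑ j, c j * Height.logHeight (fun i => MvPolynomial.aeval ![x, y] (T j i)) ≤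
        δ * Height.logHeight ![(1 : ℚ), x, y] := by
    intro P hP
    by_cases hg : (haveI : (Ideal.span {P}).IsPrime := (Ideal.span_singleton_prime hP.ne_zero).mpr hP; ∀ D : Literature.NumberTheory.DiophantineGeometry.AlgFunctionField.Divisor ℚ (FractionRing (MvPolynomial (Fin 2) ℚ ⧸ Ideal.span {P})), D.degree + 1 - (Literature.NumberTheory.DiophantineGeometry.AlgFunctionField.ell D : ℤ) ≤ 1)
    · exact hB m n T c C hFF P hP hg δ hδ
    · have hfin := hM P hP hg
      obtain ⟨B, hBd⟩ :=
        (hfin.image (fun p : ℚ × ℚ => Height.logHeight ![(1 : ℚ), p.1, p.2])).bddAbove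
      refine ⟨B + 1, fun x y hPxy _ hH => ?_⟩
      exfalso
      have hle : Height.logHeight ![(1 : ℚ), x, y] ≤ B :=
        hBd (Set.mem_image_of_mem (fun p : ℚ × ℚ => Height.logHeight ![(1 : ℚ), p.1, p.2])
          (show ((x, y) : ℚ × ℚ) ∈ {p : ℚ × ℚ | MvPolynomial.aeval ![p.1, p.2] P = 0} from hPxy))
      linarith
  choose! Hf hHf using key
  refine ⟨max HA (∑ P ∈ S, max (Hf P) 0), fun x y hT hH => ?_⟩
  by_cases hGxy : MvPolynomial.aeval ![x, y] G = 0
  · obtain ⟨P, hPS, hP0⟩ := hroot x y hGxy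
    have h1 : Hf P ≤ ∑ Q ∈ S, max (Hf Q) 0 :=
      (le_max_left _ _).trans
        (Finset.single_le_sum (f := fun Q => max (Hf Q) 0) (fun Q _ => le_max_right _ _) hPS)
    exact hHf P (hSprime P hPS) x y hP0 hT (h1.trans ((le_max_right _ _).trans hH))
  · exact hAH x y hT hGxy ((le_max_left _ _).trans hH)

/-- **Composition (kernel-checked): the crux BY NAME from the three registered stubs.** [folklore] -/
theorem LinearLawTransfer_of : Summit.ABC.ABC.Theses.GvfSupportTransfer.LinearLawTransfer :=
  linearLawTransfer_of_stubs stub_genericLawTransfer stub_lowGenusCurveLaw stub_planeMordell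

end Summit.ABC.ABC.Cruxes.LinearLawTransfer.ExceptionalCurve
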